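import Mathlib
import Summits.Ventures.PercRepro2.Defs
import Summits.Ventures.PercRepro2.CoinKStarLattice
import Summits.Ventures.PercRepro2.CoinKStarTilt

/-!
# The case analysis of the k-star proof (blind cell PercRepro2, night-2 g5;
proofs/NIGHT2-DARC.md §26.2–§26.4)

Pure real arithmetic: `shift_sum_identity` — the cleared identity
`pw μ · Σ μ (xΛ − A)(yΛ − B) = Λ²·pk μ x y + (Λ·pm μ x − A·pw μ)(Λ·pm μ y − B·pw μ)` of a shift
sum; `kStar_cases` — the three-case sign split on `(m̄₂ − m̄, n̄₂ − n̄)`; `kStar_main` — the main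
case of the abstract k-star lemma (all masses positive) from the cleared identities of the three
shift sums, FKG, (F1)–(F5) and Lemma A in cleared form; and the congruence of `pw`, `pm`, `pk`
under agreement of the weights on the powerset.
-/

namespace Summit.Ventures.PercRepro2.Coin

section KStarCases

open Classical

variable {V : Type*} [Fintype V] [DecidableEq V] {R : Type*} [Field R] [LinearOrder R]
  [IsStrictOrderedRing R]

/-! ### The real-number case analysis -/

/-- **The three-case sign split** of §26.4, on real numbers: `U_j ≥ 0` are the unnormalised
covariances, `W_j` the masses, `m_j, n_j` the means of the three weight families and `m, n` the
global means; `S′/Λ² = [U₁ + W₁(m₁−m)(n₁−n)] + [U_ω + Ω(m_ω−m)(n_ω−n)] − [U₂ + W₂(m₂−m)(n₂−n)]`. -/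
lemma kStar_cases (U₁ U₂ Uω W₁ W₂ Ω m m₁ m₂ mω n n₁ n₂ nω : R) (hU₁ : 0 ≤ U₁)
    (hU : U₂ ≤ Uω) (hW₂ : 0 ≤ W₂) (hW₁ : W₂ ≤ W₁) (hΩ : W₂ ≤ Ω) (hm₁ : m₁ ≤ m) (hn₁ : n₁ ≤ n)
    (hm₁₂ : m₁ ≤ m₂) (hn₁₂ : n₁ ≤ n₂) (hm₂ω : m₂ ≤ mω) (hn₂ω : n₂ ≤ nω) (hmω : m ≤ mω)
    (hnω : n ≤ nω) :
    0 ≤ (U₁ + W₁ * ((m₁ - m) * (n₁ - n))) + (Uω + Ω * ((mω - m) * (nω - n))) -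
      (U₂ + W₂ * ((m₂ - m) * (n₂ - n))) := by
  have hW₁0 : 0 ≤ W₁ := hW₂.trans hW₁
  have hΩ0 : 0 ≤ Ω := hW₂.trans hΩ
  have hC₁ : 0 ≤ W₁ * ((m₁ - m) * (n₁ - n)) :=
    mul_nonneg hW₁0 (mul_nonneg_of_nonpos_of_nonpos (by linarith) (by linarith))
  have hMω : 0 ≤ Ω * ((mω - m) * (nω - n)) :=
    mul_nonneg hΩ0 (mul_nonneg (by linarith) (by linarith))
  rcases le_or_gt m₂ m with h₂m | h₂m
  · rcases le_or_gt n₂ n with h₂n | h₂n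
    · -- both ≤ : the C₂-shift is dominated by the C₁-shift
      have h1 : W₂ * ((m - m₂) * (n - n₂)) ≤ W₁ * ((m - m₁) * (n - n₁)) :=
        mul_le_mul hW₁ (mul_le_mul (by linarith) (by linarith) (by linarith) (by linarith))
          (mul_nonneg (by linarith) (by linarith)) hW₁0
      have e1 : W₂ * ((m₂ - m) * (n₂ - n)) = W₂ * ((m - m₂) * (n - n₂)) := by ring
      have e2 : W₁ * ((m₁ - m) * (n₁ - n)) = W₁ * ((m - m₁) * (n - n₁)) := by ring
      linarith
    · -- mixed: the C₂-shift is ≤ 0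
      have h1 : W₂ * ((m₂ - m) * (n₂ - n)) ≤ 0 :=
        mul_nonpos_of_nonneg_of_nonpos hW₂ (mul_nonpos_of_nonpos_of_nonneg (by linarith) (by linarith))
      linarith
  · rcases le_or_gt n₂ n with h₂n | h₂n
    · -- mixed
      have h1 : W₂ * ((m₂ - m) * (n₂ - n)) ≤ 0 :=
        mul_nonpos_of_nonneg_of_nonpos hW₂ (mul_nonpos_of_nonneg_of_nonpos (by linarith) (by linarith))
      linarith
    · -- both ≥ : the C₂-shift is dominated by the M₁-shift
      have h1 : W₂ * ((m₂ - m) * (n₂ - n)) ≤ Ω * ((mω - m) * (nω - n)) :=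
        mul_le_mul hΩ (mul_le_mul (by linarith) (by linarith) (by linarith) (by linarith))
          (mul_nonneg (by linarith) (by linarith)) hΩ0
      linarith

omit [Fintype V] [DecidableEq V] [IsStrictOrderedRing R] in
/-- The mean-form conversion of a cleared shift identity. -/
lemma shift_mean_form (Λ A B W Mx My K Sh : R) (hW : 0 < W) (hΛ : 0 < Λ)
    (id : W * Sh = Λ ^ 2 * K + (Λ * Mx - A * W) * (Λ * My - B * W)) :
    Sh = Λ ^ 2 * (K / W + W * ((Mx / W - A / Λ) * (My / W - B / Λ))) := by
  have hW' := hW.ne'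
  have hΛ' := hΛ.ne'
  have h : W * (Λ ^ 2 * (K / W + W * ((Mx / W - A / Λ) * (My / W - B / Λ)))) = W * Sh := by
    rw [id]
    field_simp
  exact (mul_right_injective₀ hW' h).symm

omit [Fintype V] [DecidableEq V] in
/-- **The main case** of the abstract k-star lemma (all masses positive), on real numbers:
the cleared identities of the three shift sums, FKG, (F2)–(F5), (F1) and Lemma A in cleared
form give `S′ = Sh₁ + (Shω − Sh₂) ≥ 0` through `kStar_cases`. -/
lemma kStar_main (Λ Fa Fb W₁ W₂ Ω Mx₁ My₁ Mx₂ My₂ Mxω Myω K₁ K₂ Kω Sh₁ Sh₂ Shω : R)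
    (hW₁ : 0 < W₁) (hW₂ : 0 < W₂) (hΩ : 0 < Ω) (hΛ : 0 < Λ)
    (id₁ : W₁ * Sh₁ = Λ ^ 2 * K₁ + (Λ * Mx₁ - Fa * W₁) * (Λ * My₁ - Fb * W₁))
    (id₂ : W₂ * Sh₂ = Λ ^ 2 * K₂ + (Λ * Mx₂ - Fa * W₂) * (Λ * My₂ - Fb * W₂))
    (idω : Ω * Shω = Λ ^ 2 * Kω + (Λ * Mxω - Fa * Ω) * (Λ * Myω - Fb * Ω))
    (hK₁ : 0 ≤ K₁) (hF5 : K₂ * Ω ≤ Kω * W₂) (hF4a : W₂ ≤ W₁) (hF4b : W₂ ≤ Ω)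
    (hm₁ : Mx₁ * Λ ≤ Fa * W₁) (hn₁ : My₁ * Λ ≤ Fb * W₁)
    (hF2x : Mx₁ * W₂ ≤ Mx₂ * W₁) (hF2y : My₁ * W₂ ≤ My₂ * W₁)
    (hF3x : Mx₂ * Ω ≤ Mxω * W₂) (hF3y : My₂ * Ω ≤ Myω * W₂)
    (hLAx : Fa * Ω ≤ Mxω * Λ) (hLAy : Fb * Ω ≤ Myω * Λ) :
    0 ≤ Sh₁ + (Shω - Sh₂) := by
  rw [shift_mean_form Λ Fa Fb W₁ Mx₁ My₁ K₁ Sh₁ hW₁ hΛ id₁,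
    shift_mean_form Λ Fa Fb W₂ Mx₂ My₂ K₂ Sh₂ hW₂ hΛ id₂,
    shift_mean_form Λ Fa Fb Ω Mxω Myω Kω Shω hΩ hΛ idω]
  have hcases := kStar_cases (K₁ / W₁) (K₂ / W₂) (Kω / Ω) W₁ W₂ Ω (Fa / Λ) (Mx₁ / W₁)
    (Mx₂ / W₂) (Mxω / Ω) (Fb / Λ) (My₁ / W₁) (My₂ / W₂) (Myω / Ω)
    (div_nonneg hK₁ hW₁.le)
    ((div_le_div_iff₀ hW₂ hΩ).mpr hF5) hW₂.le hF4a hF4b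
    ((div_le_div_iff₀ hW₁ hΛ).mpr hm₁)
    ((div_le_div_iff₀ hW₁ hΛ).mpr hn₁)
    ((div_le_div_iff₀ hW₁ hW₂).mpr hF2x)
    ((div_le_div_iff₀ hW₁ hW₂).mpr hF2y)
    ((div_le_div_iff₀ hW₂ hΩ).mpr hF3x)
    ((div_le_div_iff₀ hW₂ hΩ).mpr hF3y)
    ((div_le_div_iff₀ hΛ hΩ).mpr hLAx)
    ((div_le_div_iff₀ hΛ hΩ).mpr hLAy)
  have e : Λ ^ 2 * (K₁ / W₁ + W₁ * ((Mx₁ / W₁ - Fa / Λ) * (My₁ / W₁ - Fb / Λ))) +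
      (Λ ^ 2 * (Kω / Ω + Ω * ((Mxω / Ω - Fa / Λ) * (Myω / Ω - Fb / Λ))) -
        Λ ^ 2 * (K₂ / W₂ + W₂ * ((Mx₂ / W₂ - Fa / Λ) * (My₂ / W₂ - Fb / Λ)))) =
      Λ ^ 2 * ((K₁ / W₁ + W₁ * ((Mx₁ / W₁ - Fa / Λ) * (My₁ / W₁ - Fb / Λ))) +
        (Kω / Ω + Ω * ((Mxω / Ω - Fa / Λ) * (Myω / Ω - Fb / Λ))) -
        (K₂ / W₂ + W₂ * ((Mx₂ / W₂ - Fa / Λ) * (My₂ / W₂ - Fb / Λ)))) := by ring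
  rw [e]
  exact mul_nonneg (sq_nonneg _) hcases

/-! ### The shift identity -/

omit [Fintype V] [DecidableEq V] [LinearOrder R] [IsStrictOrderedRing R] in
/-- `Σ μ (xΛ − A)(yΛ − B) = Λ²·pm μ (xy) − ΛB·pm μ x − ΛA·pm μ y + AB·pw μ`. -/
lemma shift_sum_expand (Vs : Finset V) (μ x y : Finset V → R) (Λ A B : R) :
    ∑ L ∈ Vs.powerset, μ L * (x L * Λ - A) * (y L * Λ - B) =
      Λ ^ 2 * pm Vs μ (fun L => x L * y L) - Λ * B * pm Vs μ x - Λ * A * pm Vs μ y +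
        A * B * pw Vs μ := by
  simp only [pm, pw, Finset.mul_sum, ← Finset.sum_sub_distrib, ← Finset.sum_add_distrib]
  exact Finset.sum_congr rfl fun L _ => by ring

omit [Fintype V] [DecidableEq V] [LinearOrder R] [IsStrictOrderedRing R] in
/-- The cleared identity `pw μ · Σ μ (xΛ − A)(yΛ − B) = Λ²·pk μ x y + (Λ·pm μ x − A·pw μ)(Λ·pm μ y − B·pw μ)`. -/
lemma shift_sum_identity (Vs : Finset V) (μ x y : Finset V → R) (Λ A B : R) :
    pw Vs μ * ∑ L ∈ Vs.powerset, μ L * (x L * Λ - A) * (y L * Λ - B) =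
      Λ ^ 2 * pk Vs μ x y + (Λ * pm Vs μ x - A * pw Vs μ) * (Λ * pm Vs μ y - B * pw Vs μ) := by
  rw [shift_sum_expand, pk]; ring

/-! ### Congruence of the bracket under agreement on the powerset -/

omit [Fintype V] [DecidableEq V] [LinearOrder R] [IsStrictOrderedRing R] in
/-- `pw` only depends on the weight on the powerset. -/
lemma pw_congr {Vs : Finset V} {μ μ' : Finset V → R} (h : ∀ L ⊆ Vs, μ L = μ' L) :
    pw Vs μ = pw Vs μ' :=
  Finset.sum_congr rfl fun L hL => h L (Finset.mem_powerset.mp hL)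

omit [Fintype V] [DecidableEq V] [LinearOrder R] [IsStrictOrderedRing R] in
/-- `pm` only depends on the weight on the powerset. -/
lemma pm_congr {Vs : Finset V} {μ μ' : Finset V → R} (h : ∀ L ⊆ Vs, μ L = μ' L)
    (x : Finset V → R) : pm Vs μ x = pm Vs μ' x :=
  Finset.sum_congr rfl fun L hL => by rw [h L (Finset.mem_powerset.mp hL)]

omit [Fintype V] [DecidableEq V] [LinearOrder R] [IsStrictOrderedRing R] in
/-- `pk` only depends on the weight on the powerset. -/
lemma pk_congr {Vs : Finset V} {μ μ' : Finset V → R} (h : ∀ L ⊆ Vs, μ L = μ' L)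
    (x y : Finset V → R) : pk Vs μ x y = pk Vs μ' x y := by
  simp only [pk, pw_congr h, pm_congr h]


end KStarCases

end Summit.Ventures.PercRepro2.Coin
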